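import Mathlib
import Literature.NumberTheory.LFunctions.Zhang2022.Section14Prop141OfFour
import Literature.NumberTheory.LFunctions.Zhang2022.Section14Eq146Leg2
import Literature.NumberTheory.LFunctions.Zhang2022.Section14Eq148Leg1Twisted
import HarnessLib

/-!
# Zhang (2022) §14, (14.8): the large-conductor leg `D³ ≤ r ≤ 2DP₄` at the modulus `Dk` (W-leg2) from
# the lane's generic CORE-large engine, and `Skeleton.Prop141` from CORE-large + `leg1₂`

Topic `Literature/NumberTheory/LFunctions/Zhang2022` (Landau–Siegel audit tree; verdict-neutral).
Y. Zhang, *Discrete mean estimates and the Landau–Siegel zero*, arXiv:2211.02515v1 (2022)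
[Zhang2022LandauSiegel] — **an unrefereed manuscript under adjudication**; nothing here asserts or
denies its Theorems 1–2 or Proposition 14.1. ZHANG-L discharge lane, WP14 (seat zl-w14-p2), helper
under the leaf `Skeleton.Prop141` (rows G-adj2-4, G-L3t7-1; WP14-PLAN v1.1 §2.1, the `N = D` instance
slot of CORE-large).

"for `D³ ≤ r < 2DP₄` we use the Mellin transform, Lemma 5.4 (i) and the large sieve inequality"
(§14 p.79, tex L3962–L3963). The lane proves that sentence ONCE as the coefficient-, weight- and
modulus-generic estimate **CORE-large** (WP14-PLAN §2.2, Sketch `legSum_large_le`; stated here inline as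
a hypothesis, word for word as in `Section14Eq146Leg2`): for `1 ≤ N ≤ D`, `|c(l)| ≤ M·τ₅(l)`,
`|w(p)| ≤ W` and any `r`-range `S ⊆ [D³, 2NP₄]`,
`Σ_{r∈S} Σ_{h<P/r} N/(φ(hr)h√r) Σ*_{θ≠χ} ‖Σ_{(l,h)=1} c(l)θ(l) Σ_{p∼P} χθ̄(p)w(p)Δ(l/(phr))‖ ≤ C·M·W·𝓛ᵏ·P²·D^{−c}`.
This THEOREM-ONLY file is the `N = D` twin of zl-libA-p7's `eq146leg2_of_core` (`N = D₂`):

* `wleg2_of_core` — CORE-large ⇒ **W-leg2**, the hypothesis `hleg2` of `prop141_of_legs` /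
  `prop141_of_four` (`rhs1417OnW χ β 𝐤* ((Icc 2 ⌊2DP₄⌋).filter (¬ r < D³)) ≤ C'·P²·D^{−c/2}` for
  `|β| < 5α` under (14.1)–(14.2)): instance `N = D`, `c = κ*(d·)` with `M = B·τ₅(d)`
  (`MeanSquareMajorant.tau_mul_le`), `w = (pt₀)^β` with `W = e^{15π}` (`norm_wt_le`), the
  `h`-divisibility filter `D/(D,r) ∣ h` dropped (non-negative terms), then `Σ_{d≤2P₄} τ₅(d)/d ≤ 32𝓛⁴⁵`
  and `𝓛^{k+45} ≤ D^{c/2}` eventually (`exists_ell_pow_le_rpow`);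
* `prop141_of_core` — **`Skeleton.Prop141` ⇐ CORE-large ∧ leg1₂**: `prop141_of_four` with W-leg1 =
  the tree theorem `eq148leg1W_holds` (zl-w14-p7), W-leg2 = `wleg2_of_core`, and leg2₂ =
  `eq146leg2_of_core` (zl-libA-p7); so the leaf's remaining inputs are the generic engine and the
  small-conductor leg at the modulus `D₂k`.

No new definition, no new claim; no Assumption (A) is used beyond passing it on.

## References

* Y. Zhang, arXiv:2211.02515v1 (2022), §14 pp. 78–79: (14.8) proof, u017, tex L3945–L3969.
  [cite: Zhang2022LandauSiegel, §14 (14.8) p.79, tex L3956–L3963]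
-/

noncomputable section

open Complex Real ComplexConjugate

namespace Literature.NumberTheory.LFunctions.Zhang2022.Typed.Sec14

open Skeleton DirichletCharacter

/-! ## W-leg2 from CORE-large -/

/-- **W-leg2 from the generic large-conductor engine** (WP14-PLAN Sketch `legSum_large_le`, stated
inline as the hypothesis): instance `N = D`, `c = κ*(d·)`, `M = B·τ₅(d)`, `w = (pt₀)^β`, `W = e^{15π}`,
`S = {D³ ≤ r ≤ 2DP₄}`; the `h`-filter `D/(D,r) ∣ h` of `rhs1417OnW` is dropped,
`Σ_{d≤2P₄} τ₅(d)/d ≤ 32𝓛⁴⁵`, `𝓛^{k+45} ≤ D^{c/2}`; output `≤ 32|C|·|B|·e^{15π}·P²·D^{−c/2}`, uniform in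
`|β| < 5α` (RN-01 H1). [cite: Zhang2022LandauSiegel, §14 (14.8) proof p.79, tex L3962–L3963] -/
theorem wleg2_of_core
    (hcore : ∃ c : ℝ, 0 < c ∧ ∃ k : ℕ, ∃ C : ℝ, ForAllLarge fun D _ χ => AssumptionA D χ →
      ∀ (N : ℕ) (M W : ℝ) (w cf : ℕ → ℂ), 0 ≤ M → 0 ≤ W → 1 ≤ N → N ≤ D →
        (∀ l : ℕ, ‖cf l‖ ≤ M * MeanSquareMajorant.tau 5 l) →
        (∀ p ∈ primeWindow D, ‖w p‖ ≤ W) →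
        ∀ S : Finset ℕ, (∀ r ∈ S, D ^ 3 ≤ r ∧ (r : ℝ) ≤ 2 * N * P4 D) →
          ∑ r ∈ S, ∑ h ∈ Finset.Ico 1 ⌈bigP D / r⌉₊,
              (N : ℝ) / ((Nat.totient (h * r) : ℝ) * h * Real.sqrt r) *
                ∑ θ ∈ finsetOf {θ : DirichletCharacter ℂ r | θ.IsPrimitive ∧
                    changeLevel (dvd_mul_left r D) θ ≠ changeLevel (dvd_mul_right D r) χ},
                  ‖∑' l : ℕ, if Nat.Coprime l h then
                      cf l * θ (l : ZMod r) *
                        ∑ p ∈ primeWindow D, χ (p : ZMod D) * θ⁻¹ (p : ZMod r) * w p *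
                          DeltaW D ((l : ℝ) / ((p : ℝ) * h * r)) else 0‖
            ≤ C * M * W * ell D ^ k * bigP D ^ 2 * (D : ℝ) ^ (-c)) :
    ∀ B : ℝ, ∃ c : ℝ, 0 < c ∧ ∃ C : ℝ, ForAllLarge fun D _ χ => AssumptionA D χ →
      ∀ β : ℂ, ‖β‖ < 5 * alpha D → ∀ κs as : ℕ → ℂ, Eq141 B κs → Eq142 D B as →
        rhs1417OnW χ β κs ((Finset.Icc 2 ⌊2 * (D : ℝ) * P4 D⌋₊).filter (fun r => ¬ r < D ^ 3))
          ≤ C * bigP D ^ 2 * (D : ℝ) ^ (-c) := by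
  intro B
  obtain ⟨c, hc, k, C, Dc, hC⟩ := hcore
  obtain ⟨Dl, hDl⟩ := exists_ell_pow_le_rpow (k + 45) (half_pos hc)
  obtain ⟨D₃, hD₃⟩ := exists_nat_forall_le_ell 3
  obtain ⟨Dp, hDp⟩ := exists_two_mul_P4_le_bigP
  set W : ℝ := Real.exp (15 * π) with hW_def
  have hW0 : 0 ≤ W := (Real.exp_pos _).le
  refine ⟨c / 2, half_pos hc, 32 * |C| * |B| * W, ?_⟩
  refine ⟨max (max Dc Dl) (max D₃ Dp), fun D _ χ hD hq hprim hA β hβ κs as h141 h142 => ?_⟩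
  have hDc : Dc ≤ D := le_trans (le_trans (le_max_left _ _) (le_max_left _ _)) hD
  have hDl' : Dl ≤ D := le_trans (le_trans (le_max_right _ _) (le_max_left _ _)) hD
  have hD₃' : D₃ ≤ D := le_trans (le_trans (le_max_left _ _) (le_max_right _ _)) hD
  have hDp' : Dp ≤ D := le_trans (le_trans (le_max_right _ _) (le_max_right _ _)) hD
  have hℓ3 : 3 ≤ ell D := hD₃ D hD₃'
  have hℓ1 : 1 ≤ ell D := by linarith
  have hDne : D ≠ 0 := NeZero.ne D
  have hD0 : (0 : ℝ) < D := by exact_mod_cast Nat.pos_of_ne_zero hDne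
  have hDone : 1 ≤ D := Nat.pos_of_ne_zero hDne
  have hB0 : 0 ≤ B := (norm_nonneg _).trans (h142.1 0)
  have hP0 : 0 < bigP D := Real.exp_pos _
  have hP4 : 0 ≤ P4 D := by
    rw [P4, t0]
    exact mul_nonneg (div_nonneg hP0.le (pow_nonneg (Real.exp_pos _).le 2))
      (pow_nonneg (Real.log_natCast_nonneg D) 519)
  -- the weight
  have hw : ∀ p ∈ primeWindow D, ‖wt D β p‖ ≤ W := fun p hp => norm_wt_le hℓ3 hp hβ.le
  -- the `r`-range
  set S : Finset ℕ := (Finset.Icc 2 ⌊2 * (D : ℝ) * P4 D⌋₊).filter (fun r => ¬ r < D ^ 3) with hS_def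
  have hS : ∀ r ∈ S, D ^ 3 ≤ r ∧ (r : ℝ) ≤ 2 * D * P4 D := by
    intro r hr
    obtain ⟨hr1, hr2⟩ := Finset.mem_filter.mp hr
    refine ⟨not_lt.mp hr2, ?_⟩
    have h2 := (Finset.mem_Icc.mp hr1).2
    have h0 : 0 ≤ 2 * (D : ℝ) * P4 D := by positivity
    calc (r : ℝ) ≤ ⌊2 * (D : ℝ) * P4 D⌋₊ := by exact_mod_cast h2
      _ ≤ 2 * (D : ℝ) * P4 D := Nat.floor_le h0
  have hCore := hC D χ hDc hq hprim hA
  -- the main constant per `D`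
  set K₀ : ℝ := |C| * |B| * W * ell D ^ k * bigP D ^ 2 * (D : ℝ) ^ (-c) with hK₀
  have hK₀0 : 0 ≤ K₀ := by rw [hK₀]; positivity
  -- per `d`: the engine at `N = D`, `cf = κ*(d·)`, `M = B·τ₅(d)`
  have hper : ∀ d ∈ Finset.Icc 1 ⌊2 * P4 D⌋₊,
        ∑ r ∈ S, ∑ h ∈ (Finset.Ico 1 ⌈bigP D / r⌉₊).filter (fun h => D / Nat.gcd D r ∣ h),
            (D : ℝ) / ((Nat.totient (h * r) : ℝ) * h * Real.sqrt r) *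
              ∑ θ ∈ finsetOf {θ : DirichletCharacter ℂ r | θ.IsPrimitive ∧
                  changeLevel (dvd_mul_left r D) θ ≠ changeLevel (dvd_mul_right D r) χ},
                ‖∑' l : ℕ, if Nat.Coprime l h then
                    (fun l => κs (d * l)) l * θ (l : ZMod r) *
                      ∑ p ∈ primeWindow D, χ (p : ZMod D) * θ⁻¹ (p : ZMod r) * wt D β p *
                        DeltaW D ((l : ℝ) / ((p : ℝ) * h * r)) else 0‖
        ≤ K₀ * MeanSquareMajorant.tau 5 d := by
    intro d hd
    set M : ℝ := B * MeanSquareMajorant.tau 5 d with hM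
    have hM0 : 0 ≤ M := mul_nonneg hB0 (MeanSquareMajorant.tau_nonneg _ _)
    have hcf : ∀ l : ℕ, ‖(fun l => κs (d * l)) l‖ ≤ M * MeanSquareMajorant.tau 5 l := by
      intro l
      calc ‖κs (d * l)‖ ≤ B * MeanSquareMajorant.tau 5 (d * l) := norm_le_tau_of_eq141 h141 _
        _ ≤ B * (MeanSquareMajorant.tau 5 d * MeanSquareMajorant.tau 5 l) :=
            mul_le_mul_of_nonneg_left (MeanSquareMajorant.tau_mul_le 5 _ _) hB0
        _ = M * MeanSquareMajorant.tau 5 l := by rw [hM]; ring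
    have hleg := hCore D M W (wt D β) (fun l => κs (d * l)) hM0 hW0 hDone le_rfl hcf hw S hS
    -- drop the `h`-filter
    have hdrop :
        ∑ r ∈ S, ∑ h ∈ (Finset.Ico 1 ⌈bigP D / r⌉₊).filter (fun h => D / Nat.gcd D r ∣ h),
            (D : ℝ) / ((Nat.totient (h * r) : ℝ) * h * Real.sqrt r) *
              ∑ θ ∈ finsetOf {θ : DirichletCharacter ℂ r | θ.IsPrimitive ∧
                  changeLevel (dvd_mul_left r D) θ ≠ changeLevel (dvd_mul_right D r) χ},
                ‖∑' l : ℕ, if Nat.Coprime l h then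
                    (fun l => κs (d * l)) l * θ (l : ZMod r) *
                      ∑ p ∈ primeWindow D, χ (p : ZMod D) * θ⁻¹ (p : ZMod r) * wt D β p *
                        DeltaW D ((l : ℝ) / ((p : ℝ) * h * r)) else 0‖ ≤
        ∑ r ∈ S, ∑ h ∈ Finset.Ico 1 ⌈bigP D / r⌉₊,
            (D : ℝ) / ((Nat.totient (h * r) : ℝ) * h * Real.sqrt r) *
              ∑ θ ∈ finsetOf {θ : DirichletCharacter ℂ r | θ.IsPrimitive ∧
                  changeLevel (dvd_mul_left r D) θ ≠ changeLevel (dvd_mul_right D r) χ},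
                ‖∑' l : ℕ, if Nat.Coprime l h then
                    (fun l => κs (d * l)) l * θ (l : ZMod r) *
                      ∑ p ∈ primeWindow D, χ (p : ZMod D) * θ⁻¹ (p : ZMod r) * wt D β p *
                        DeltaW D ((l : ℝ) / ((p : ℝ) * h * r)) else 0‖ := by
      refine Finset.sum_le_sum fun r _ => ?_
      refine Finset.sum_le_sum_of_subset_of_nonneg (Finset.filter_subset _ _) fun h _ _ => ?_
      exact mul_nonneg (div_nonneg (Nat.cast_nonneg _) (by positivity))
        (Finset.sum_nonneg fun θ _ => norm_nonneg _)
    refine hdrop.trans (hleg.trans ?_)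
    -- `C·M·W·𝓛ᵏ·P²·D^{-c} ≤ K₀·τ₅(d)`
    have hrest : 0 ≤ W * ell D ^ k * bigP D ^ 2 * (D : ℝ) ^ (-c) := by positivity
    calc C * M * W * ell D ^ k * bigP D ^ 2 * (D : ℝ) ^ (-c)
        ≤ |C| * M * W * ell D ^ k * bigP D ^ 2 * (D : ℝ) ^ (-c) := by
          have : C * M ≤ |C| * M := mul_le_mul_of_nonneg_right (le_abs_self C) hM0
          have h2 : C * M * (W * ell D ^ k * bigP D ^ 2 * (D : ℝ) ^ (-c)) ≤
              |C| * M * (W * ell D ^ k * bigP D ^ 2 * (D : ℝ) ^ (-c)) :=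
            mul_le_mul_of_nonneg_right this hrest
          linarith [h2]
      _ = (|C| * W * ell D ^ k * bigP D ^ 2 * (D : ℝ) ^ (-c)) * (B * MeanSquareMajorant.tau 5 d) := by
          rw [hM]; ring
      _ ≤ (|C| * W * ell D ^ k * bigP D ^ 2 * (D : ℝ) ^ (-c)) *
            (|B| * MeanSquareMajorant.tau 5 d) := by
          refine mul_le_mul_of_nonneg_left ?_ (by positivity)
          exact mul_le_mul_of_nonneg_right (le_abs_self B) (MeanSquareMajorant.tau_nonneg _ _)
      _ = K₀ * MeanSquareMajorant.tau 5 d := by rw [hK₀]; ring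
  -- sum over `d`
  have hdsum : ∑ d ∈ Finset.Icc 1 ⌊2 * P4 D⌋₊, MeanSquareMajorant.tau 5 d / d ≤ 32 * ell D ^ 45 := by
    refine (MeanSquareMajorant.sum_tau_div_Icc_le_log_pow 5 ⌊2 * P4 D⌋₊).trans ?_
    have hlogK : Real.log (⌊2 * P4 D⌋₊ : ℕ) ≤ ell D ^ 9 := by
      have hlogP : Real.log (bigP D) = ell D ^ 9 := by rw [bigP, Real.log_exp]
      rcases Nat.eq_zero_or_pos ⌊2 * P4 D⌋₊ with h0 | hpos
      · rw [h0, Nat.cast_zero, Real.log_zero]; positivity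
      · rw [← hlogP]
        refine Real.log_le_log (by exact_mod_cast hpos) ?_
        exact (Nat.floor_le (by positivity)).trans (hDp D hDp')
    have h9 : (1 : ℝ) ≤ ell D ^ 9 := one_le_pow₀ hℓ1
    have hlog0 : 0 ≤ Real.log (⌊2 * P4 D⌋₊ : ℕ) := Real.log_natCast_nonneg _
    calc (1 + Real.log (⌊2 * P4 D⌋₊ : ℕ)) ^ 5 ≤ (2 * ell D ^ 9) ^ 5 :=
          pow_le_pow_left₀ (by linarith) (by linarith) 5
      _ = 32 * ell D ^ 45 := by ring
  have hlogpow : ell D ^ (k + 45) ≤ (D : ℝ) ^ (c / 2) := hDl D hDl'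
  -- unfold the twisted u017 majorant and assemble
  unfold rhs1417OnW
  calc
      ∑ d ∈ Finset.Icc 1 ⌊2 * P4 D⌋₊, (d : ℝ)⁻¹ *
        ∑ r ∈ S,
          ∑ h ∈ (Finset.Ico 1 ⌈bigP D / r⌉₊).filter (fun h => D / Nat.gcd D r ∣ h),
            (D : ℝ) / ((Nat.totient (h * r) : ℝ) * h * Real.sqrt r) *
              ∑ θ ∈ finsetOf {θ : DirichletCharacter ℂ r | θ.IsPrimitive ∧
                  changeLevel (dvd_mul_left r D) θ ≠ changeLevel (dvd_mul_right D r) χ},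
                ‖∑' l : ℕ, if Nat.Coprime l h then κs (d * l) * θ (l : ZMod r) *
                    ∑ p ∈ primeWindow D, χ (p : ZMod D) * θ⁻¹ (p : ZMod r) * wt D β p *
                      DeltaW D ((l : ℝ) / ((p : ℝ) * h * r)) else 0‖
      ≤ ∑ d ∈ Finset.Icc 1 ⌊2 * P4 D⌋₊, (d : ℝ)⁻¹ * (K₀ * MeanSquareMajorant.tau 5 d) := by
        refine Finset.sum_le_sum fun d hd => ?_
        exact mul_le_mul_of_nonneg_left (hper d hd) (inv_nonneg.mpr (Nat.cast_nonneg d))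
    _ = K₀ * ∑ d ∈ Finset.Icc 1 ⌊2 * P4 D⌋₊, MeanSquareMajorant.tau 5 d / d := by
        rw [Finset.mul_sum]
        refine Finset.sum_congr rfl fun d _ => ?_
        rw [div_eq_mul_inv]; ring
    _ ≤ K₀ * (32 * ell D ^ 45) := mul_le_mul_of_nonneg_left hdsum hK₀0
    _ = 32 * |C| * |B| * W * bigP D ^ 2 * (ell D ^ (k + 45) * (D : ℝ) ^ (-c)) := by
        rw [hK₀, pow_add]; ring
    _ ≤ 32 * |C| * |B| * W * bigP D ^ 2 * ((D : ℝ) ^ (c / 2) * (D : ℝ) ^ (-c)) := by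
        have h0 : 0 ≤ 32 * |C| * |B| * W * bigP D ^ 2 := by positivity
        refine mul_le_mul_of_nonneg_left ?_ h0
        exact mul_le_mul_of_nonneg_right hlogpow (Real.rpow_nonneg hD0.le _)
    _ = 32 * |C| * |B| * W * bigP D ^ 2 * (D : ℝ) ^ (-(c / 2)) := by
        rw [← Real.rpow_add hD0]; ring_nf

/-! ## The leaf from CORE-large and `leg1₂` -/

/-- **`Skeleton.Prop141` ⇐ CORE-large ∧ `leg1₂`** — Proposition 14.1 (every `|β| < 5α`, §14 p.76)
from the generic large-conductor engine (Sketch `legSum_large_le` shape, inline) and the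
small-conductor leg at the modulus `D₂k` (`leg1₂`, hypothesis `hleg1` of `eq146W_of_legs`):
`prop141_of_four` with W-leg1 = `eq148leg1W_holds` (tree), W-leg2 = `wleg2_of_core`, leg2₂ =
`eq146leg2_of_core`. [cite: Zhang2022LandauSiegel, §14 Prop. 14.1 (proof) pp.76–79, tex L3836–L3969] -/
theorem prop141_of_core
    (hcore : ∃ c : ℝ, 0 < c ∧ ∃ k : ℕ, ∃ C : ℝ, ForAllLarge fun D _ χ => AssumptionA D χ →
      ∀ (N : ℕ) (M W : ℝ) (w cf : ℕ → ℂ), 0 ≤ M → 0 ≤ W → 1 ≤ N → N ≤ D →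
        (∀ l : ℕ, ‖cf l‖ ≤ M * MeanSquareMajorant.tau 5 l) →
        (∀ p ∈ primeWindow D, ‖w p‖ ≤ W) →
        ∀ S : Finset ℕ, (∀ r ∈ S, D ^ 3 ≤ r ∧ (r : ℝ) ≤ 2 * N * P4 D) →
          ∑ r ∈ S, ∑ h ∈ Finset.Ico 1 ⌈bigP D / r⌉₊,
              (N : ℝ) / ((Nat.totient (h * r) : ℝ) * h * Real.sqrt r) *
                ∑ θ ∈ finsetOf {θ : DirichletCharacter ℂ r | θ.IsPrimitive ∧
                    changeLevel (dvd_mul_left r D) θ ≠ changeLevel (dvd_mul_right D r) χ},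
                  ‖∑' l : ℕ, if Nat.Coprime l h then
                      cf l * θ (l : ZMod r) *
                        ∑ p ∈ primeWindow D, χ (p : ZMod D) * θ⁻¹ (p : ZMod r) * w p *
                          DeltaW D ((l : ℝ) / ((p : ℝ) * h * r)) else 0‖
            ≤ C * M * W * ell D ^ k * bigP D ^ 2 * (D : ℝ) ^ (-c))
    (hleg1₂ : ∀ B : ℝ, ∃ c : ℝ, 0 < c ∧ ∃ C : ℝ, ForAllLarge fun D _ χ => AssumptionA D χ →
      ∀ β : ℂ, ‖β‖ < 5 * alpha D → ∀ κs as : ℕ → ℂ, Eq141 B κs → Eq142 D B as →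
        ∀ D₁ D₂ : ℕ, D₁ * D₂ = D → 1 < D₁ →
          ∑ d ∈ Finset.Icc 1 ⌊2 * P4 D⌋₊, (d : ℝ)⁻¹ *
            ∑ r ∈ (Finset.Icc 2 ⌊2 * (D₂ : ℝ) * P4 D⌋₊).filter (fun r => r < D ^ 3),
              ∑ h ∈ (Finset.Ico 1 ⌈bigP D / r⌉₊).filter (fun h => D₂ / Nat.gcd D₂ r ∣ h),
                (D₂ : ℝ) / ((Nat.totient (h * r) : ℝ) * h * Real.sqrt r) *
                  ∑ θ' ∈ finsetOf {θ' : DirichletCharacter ℂ r | θ'.IsPrimitive ∧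
                      changeLevel (dvd_mul_left r D) θ' ≠ changeLevel (dvd_mul_right D r) χ},
                    ‖∑' l : ℕ, if Nat.Coprime l h then κs (D₁ * d * l) * θ' (l : ZMod r) *
                        ∑ p ∈ primeWindow D, χ (p : ZMod D) * θ'⁻¹ (p : ZMod r) * wt D β p *
                        DeltaW D ((l : ℝ) / ((p : ℝ) * h * r)) else 0‖
          ≤ C * bigP D ^ 2 * (D : ℝ) ^ (-c)) :
    Prop141 :=
  prop141_of_four eq148leg1W_holds (wleg2_of_core hcore) hleg1₂ (eq146leg2_of_core hcore)

end Literature.NumberTheory.LFunctions.Zhang2022.Typed.Sec14
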